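import Summits.ValiantsHypothesis.ValiantsHypothesis.Theorems.KPlusLogSqLawTropicalSymmetricOrbitThreeFourPairs

/-!
# Route «KPlusLogSqLaw» — the symmetric `(3,4)` tropical row in the ORBIT model — abstract exclusion lemmas, part 3:
# two identity terms `{0,1,3} = D(u)`, `{0,2,3} = D(w)` against a pair carrier on `{1,1,2}` or `{1,2,2}`

HONEST FRAMING.  Helper file (seat val-sym-lift-p2 (g6), cell `pub-symmetroid`, 2026-08-27; `--supports` the `WeakLifting` item
stmt-ValiantsHypothesis-19561 as a helper, no closure claim).  A SMALL-FORMAT statement in the transpose-ORBIT carrier model, far inside the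
known regime of the cruxes; port blueprint `HOME/val-sym-lift-p2/g6/LEMMA-Z-liftp2g6.md` §6.  Nothing here is about `TropicalB` / `WeakLifting`
in their windows, Conjecture B, DoorA34 = `PosRootLawAt 3 4 18` (OPEN, never asserted), `MatrixDescartes` (stmt-ValiantsHypothesis-18050) or
VP ≠ VNP; `TSymOrb34Le17` / `TSymOrb34Le16` stay targets (NOT asserted).

THIS FILE.  `DD_frame` (the two identity terms are comparable: `w = u[κ1 ↦ 2]`), `K1` (`{1,1,2}` on a pair carrier: by R3w the pair
`{κ1,κ3}` carries the `2`, so `{κ0,κ3}` and `{κ0,κ1}` carry `1`s, giving `g 0 + g 3 < 2·g 1 < g 0 + g 2` by R3w / R3′w — absurd), `K2`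
(`{1,2,2}`: the pair `{κ0,κ1}` carries the `1` by R3′w, so `{κ0,κ3}` carries a `2` with `g 0 + g 3 < 2·g 2 < g 0 + g 3`).
[cell statement R1732; folklore-level exchange arguments, no citation exists]
-/

set_option linter.dupNamespace false
set_option autoImplicit false

namespace Summit.ValiantsHypothesis.ValiantsHypothesis.Theorems.KPlusLogSqLaw

open Summit.ValiantsHypothesis.ValiantsHypothesis.Theorems.MatrixDescartes.Negative
open Summit.ValiantsHypothesis.ValiantsHypothesis.Theorems.LacunarySymmetroidMatrixDescartes
open Summit.ValiantsHypothesis.ValiantsHypothesis.Theorems.LacunarySymmetroidMatrixDescartes.TropicalCensus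
open Finset

namespace SymmetricOrbitThreeFour

open SymmetricThreeFour SymmetricThreeFourSeventeen SymmetricThreeFourSixteen SymmetricThreeFourFifteen

/-- **`DD_frame`**: if `{0,1,3} = D(u)` (index `a`) and `{0,2,3} = D(w)` (index `b`) are both carried, then `a < b` and, with `κ0, κ1, κ3`
the columns where `u` reads `0, 1, 3`: `w κ0 = 0`, `w κ1 = 2`, `w κ3 = 3`. [hM for identity carriers] -/
theorem DD_frame {n : ℕ} (r : Fin (n + 1) → Equiv.Perm (Fin 3) × (Fin 3 → Fin 4))
    (hM : ∀ a b : Fin (n + 1), a < b → ∀ l₁ l₂ : Fin 3,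
      ((r a).1 l₁ = (r b).1 l₂ ∧ l₁ = l₂) ∨ ((r a).1 l₁ = l₂ ∧ (r b).1 l₂ = l₁) → (r a).2 l₁ ≤ (r b).2 l₂)
    (a b : Fin (n + 1)) (ha1 : (r a).1 = 1) (hb1 : (r b).1 = 1)
    (ha : TropicalCensus.classSym (r a) = TropicalCensus.classSym ((1 : Equiv.Perm (Fin 3)), (![0, 1, 3] : Fin 3 → Fin 4)))
    (hb : TropicalCensus.classSym (r b) = TropicalCensus.classSym ((1 : Equiv.Perm (Fin 3)), (![0, 2, 3] : Fin 3 → Fin 4))) :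
    a < b ∧ ∃ κ0 κ1 κ3 : Fin 3, κ0 ≠ κ1 ∧ κ3 ≠ κ0 ∧ κ3 ≠ κ1 ∧ (r a).2 κ0 = 0 ∧ (r a).2 κ1 = 1 ∧ (r a).2 κ3 = 3 ∧
      (r b).2 κ0 = 0 ∧ (r b).2 κ1 = 2 ∧ (r b).2 κ3 = 3 := by
  have ca : ∀ l, (univ.filter fun t => (r a).2 t = l).card = (![1, 1, 0, 1] : Fin 4 → ℕ) l :=
    fun l => (card_filter_eq_of_classSym_eq ha l).trans (cnt013 l)
  have cb : ∀ l, (univ.filter fun t => (r b).2 t = l).card = (![1, 0, 1, 1] : Fin 4 → ℕ) l :=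
    fun l => (card_filter_eq_of_classSym_eq hb l).trans (cnt023 l)
  have hab : a ≠ b := by intro h; have := ca 1; rw [h, cb 1] at this; exact absurd this (by decide)
  have hMD : ∀ x y : Fin (n + 1), x < y → (r x).1 = 1 → (r y).1 = 1 → ∀ l, (r x).2 l ≤ (r y).2 l :=
    fun x y hxy hx hy l => hM x y hxy l l (Or.inl ⟨by rw [hx, hy], rfl⟩)
  obtain ⟨κ0, hκ0⟩ := exists_of_card_pos ((r a).2) 0 (by rw [ca 0]; decide)
  obtain ⟨κ1, hκ1⟩ := exists_of_card_pos ((r a).2) 1 (by rw [ca 1]; decide)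
  obtain ⟨κ3, hκ3⟩ := exists_of_card_pos ((r a).2) 3 (by rw [ca 3]; decide)
  have hκ01 : κ0 ≠ κ1 := by rintro rfl; rw [hκ0] at hκ1; exact absurd hκ1 (by decide)
  have hκ30 : κ3 ≠ κ0 := by rintro rfl; rw [hκ3] at hκ0; exact absurd hκ0 (by decide)
  have hκ31 : κ3 ≠ κ1 := by rintro rfl; rw [hκ3] at hκ1; exact absurd hκ1 (by decide)
  have wb1 : ∀ t, (r b).2 t ≠ 1 := ne_of_card_zero _ 1 (by rw [cb 1]; rfl)
  have hlt : a < b := by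
    rcases lt_or_gt_of_ne hab with h | h
    · exact h
    · exfalso
      have h0 := hMD b a h hb1 ha1 κ0
      have h1 := hMD b a h hb1 ha1 κ1
      rw [hκ0] at h0; rw [hκ1] at h1
      have w0 : (r b).2 κ0 = 0 := le_antisymm h0 (Fin.zero_le _)
      have w1 : (r b).2 κ1 = 0 := f4_f _ h1 (wb1 κ1)
      have h2le := two_le_card_filter (r b) hκ01.symm (w1.trans w0.symm)
      rw [w0, cb 0] at h2le
      exact absurd h2le (by decide)
  have hw3 : (r b).2 κ3 = 3 := by
    have := hMD a b hlt ha1 hb1 κ3; rw [hκ3] at this; exact le_antisymm (Fin.le_last _) this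
  have hw1 : (r b).2 κ1 = 2 := by
    have h := hMD a b hlt ha1 hb1 κ1; rw [hκ1] at h
    have hne3 : (r b).2 κ1 ≠ 3 := ne_of_card_one _ 3 (by rw [cb 3]; rfl) hw3 hκ31.symm
    rcases f4_h _ h (wb1 κ1) with hq | hq
    · exact hq
    · exact absurd hq hne3
  have hw0 : (r b).2 κ0 = 0 := by
    have hne3 : (r b).2 κ0 ≠ 3 := ne_of_card_one _ 3 (by rw [cb 3]; rfl) hw3 hκ30.symm
    have hne2 : (r b).2 κ0 ≠ 2 := ne_of_card_one _ 2 (by rw [cb 2]; rfl) hw1 hκ01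
    rcases f4_c _ (wb1 κ0) hne2 with hq | hq
    · exact hq
    · exact absurd hq hne3
  exact ⟨hlt, κ0, κ1, κ3, hκ01, hκ30, hκ31, hκ0, hκ1, hκ3, hw0, hw1, hw3⟩

/-- **`K1`**: `{0,1,3} = D`, `{0,2,3} = D`, `{1,1,2} = C` is impossible. [R3w / R3′w on the three pairs] -/
theorem K1 {n : ℕ} (r : Fin (n + 1) → Equiv.Perm (Fin 3) × (Fin 3 → Fin 4)) (g : Fin 4 → ℕ) (hmono : Monotone g)
    (hM : ∀ a b : Fin (n + 1), a < b → ∀ l₁ l₂ : Fin 3,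
      ((r a).1 l₁ = (r b).1 l₂ ∧ l₁ = l₂) ∨ ((r a).1 l₁ = l₂ ∧ (r b).1 l₂ = l₁) → (r a).2 l₁ ≤ (r b).2 l₂)
    (hR3 : ∀ a b : Fin (n + 1), a < b → (r a).1 = 1 → ∀ i j k : Fin 3, i ≠ j → k ≠ i → k ≠ j →
      (r b).1 i = j → (r b).1 j = k → (r b).1 k = i → g ((r a).2 i) + g ((r a).2 j) < 2 * g ((r b).2 i))
    (hR3' : ∀ a b : Fin (n + 1), a < b → (r b).1 = 1 → ∀ i j k : Fin 3, i ≠ j → k ≠ i → k ≠ j →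
      (r a).1 i = j → (r a).1 j = k → (r a).1 k = i → 2 * g ((r a).2 i) < g ((r b).2 i) + g ((r b).2 j))
    (a b z : Fin (n + 1)) (ha1 : (r a).1 = 1) (hb1 : (r b).1 = 1) (hz : ∀ x, (r z).1 x ≠ x)
    (ha : TropicalCensus.classSym (r a) = TropicalCensus.classSym ((1 : Equiv.Perm (Fin 3)), (![0, 1, 3] : Fin 3 → Fin 4)))
    (hb : TropicalCensus.classSym (r b) = TropicalCensus.classSym ((1 : Equiv.Perm (Fin 3)), (![0, 2, 3] : Fin 3 → Fin 4)))
    (hzc : TropicalCensus.classSym (r z) = TropicalCensus.classSym ((1 : Equiv.Perm (Fin 3)), (![1, 1, 2] : Fin 3 → Fin 4))) : False := by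
  obtain ⟨hab, κ0, κ1, κ3, hκ01, hκ30, hκ31, hu0, hu1, hu3, hw0, hw1, hw3⟩ := DD_frame r hM a b ha1 hb1 ha hb
  have cz : ∀ l, (univ.filter fun t => (r z).2 t = l).card = (![0, 2, 1, 0] : Fin 4 → ℕ) l :=
    fun l => (card_filter_eq_of_classSym_eq hzc l).trans (cnt112 l)
  have haz : a ≠ z := by intro h; rw [h] at ha1; exact fpf_ne_one hz ha1
  have hbz : b ≠ z := by intro h; rw [h] at hb1; exact fpf_ne_one hz hb1
  have z12 : ∀ t, (r z).2 t = 2 ∨ (r z).2 t = 1 := fun t => by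
    by_cases h1 : (r z).2 t = 1
    · exact Or.inr h1
    · exact Or.inl (f4_j _ (ne_of_card_zero _ 0 (by rw [cz 0]; rfl) t) h1 (ne_of_card_zero _ 3 (by rw [cz 3]; rfl) t))
  have gz1 : ∀ t, g 1 ≤ g ((r z).2 t) := fun t => by rcases z12 t with h | h <;> rw [h]; exact hmono (by decide)
  have gz2 : ∀ t, g ((r z).2 t) ≤ g 2 := fun t => by rcases z12 t with h | h <;> rw [h]; exact hmono (by decide)
  have z_ne2 : ∀ {t t' : Fin 3}, (r z).2 t = 2 → t' ≠ t → (r z).2 t' = 1 := fun {t t'} h hne => by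
    rcases z12 t' with h' | h'
    · exact absurd h' (ne_of_card_one _ 2 (by rw [cz 2]; rfl) h hne)
    · exact h'
  have g01 : g 0 ≤ g 1 := hmono (by decide)
  have g12 : g 1 ≤ g 2 := hmono (by decide)
  have g23 : g 2 ≤ g 3 := hmono (by decide)
  rcases fpf_orient (r z).1 hz κ0 κ1 hκ01 with hor | hor
  · -- the carrier of `z` is `κ0 ↦ κ1 ↦ κ3 ↦ κ0`
    obtain ⟨h13, h30⟩ := fpf_next (r z).1 hz κ0 κ1 κ3 hκ01 hκ30 hκ31 hor
    have haz' : a < z := by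
      rcases lt_or_gt_of_ne haz with h | h
      · exact h
      · exfalso
        have hC := hR3' z a h ha1 κ0 κ1 κ3 hκ01 hκ30 hκ31 hor h13 h30
        rw [hu0, hu1] at hC; have := gz1 κ0; omega
    have hzb' : z < b := by
      rcases lt_or_gt_of_ne hbz with h | h
      · exfalso
        have hC := hR3 b z h hb1 κ1 κ3 κ0 hκ31.symm hκ01 hκ30.symm h13 h30 hor
        rw [hw1, hw3] at hC; have := gz2 κ1; omega
      · exact h
    have c1 := hR3 a z haz' ha1 κ1 κ3 κ0 hκ31.symm hκ01 hκ30.symm h13 h30 hor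
    rw [hu1, hu3] at c1
    have hz1 : (r z).2 κ1 = 2 := by
      rcases z12 κ1 with h | h
      · exact h
      · rw [h] at c1; omega
    have c2 := hR3 a z haz' ha1 κ3 κ0 κ1 hκ30 hκ31.symm hκ01.symm h30 hor h13
    rw [hu3, hu0, z_ne2 hz1 hκ31] at c2
    have c3 := hR3' z b hzb' hb1 κ0 κ1 κ3 hκ01 hκ30 hκ31 hor h13 h30
    rw [hw0, hw1, z_ne2 hz1 hκ01] at c3
    omega
  · -- the carrier of `z` is `κ1 ↦ κ0 ↦ κ3 ↦ κ1`
    obtain ⟨h03, h31⟩ := fpf_next (r z).1 hz κ1 κ0 κ3 hκ01.symm hκ31 hκ30 hor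
    have haz' : a < z := by
      rcases lt_or_gt_of_ne haz with h | h
      · exact h
      · exfalso
        have hC := hR3' z a h ha1 κ1 κ0 κ3 hκ01.symm hκ31 hκ30 hor h03 h31
        rw [hu1, hu0] at hC; have := gz1 κ1; omega
    have hzb' : z < b := by
      rcases lt_or_gt_of_ne hbz with h | h
      · exfalso
        have hC := hR3 b z h hb1 κ3 κ1 κ0 hκ31 hκ30.symm hκ01 h31 hor h03
        rw [hw3, hw1] at hC; have := gz2 κ3; omega
      · exact h
    have c1 := hR3 a z haz' ha1 κ3 κ1 κ0 hκ31 hκ30.symm hκ01 h31 hor h03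
    rw [hu3, hu1] at c1
    have hz3 : (r z).2 κ3 = 2 := by
      rcases z12 κ3 with h | h
      · exact h
      · rw [h] at c1; omega
    have c2 := hR3 a z haz' ha1 κ0 κ3 κ1 hκ30.symm hκ01.symm hκ31.symm h03 h31 hor
    rw [hu0, hu3, z_ne2 hz3 hκ30.symm] at c2
    have c3 := hR3' z b hzb' hb1 κ1 κ0 κ3 hκ01.symm hκ31 hκ30 hor h03 h31
    rw [hw1, hw0, z_ne2 hz3 hκ31.symm] at c3
    omega

/-- **`K2`**: `{0,1,3} = D`, `{0,2,3} = D`, `{1,2,2} = C` is impossible. [R3w / R3′w on the three pairs] -/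
theorem K2 {n : ℕ} (r : Fin (n + 1) → Equiv.Perm (Fin 3) × (Fin 3 → Fin 4)) (g : Fin 4 → ℕ) (hmono : Monotone g)
    (hM : ∀ a b : Fin (n + 1), a < b → ∀ l₁ l₂ : Fin 3,
      ((r a).1 l₁ = (r b).1 l₂ ∧ l₁ = l₂) ∨ ((r a).1 l₁ = l₂ ∧ (r b).1 l₂ = l₁) → (r a).2 l₁ ≤ (r b).2 l₂)
    (hR3 : ∀ a b : Fin (n + 1), a < b → (r a).1 = 1 → ∀ i j k : Fin 3, i ≠ j → k ≠ i → k ≠ j →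
      (r b).1 i = j → (r b).1 j = k → (r b).1 k = i → g ((r a).2 i) + g ((r a).2 j) < 2 * g ((r b).2 i))
    (hR3' : ∀ a b : Fin (n + 1), a < b → (r b).1 = 1 → ∀ i j k : Fin 3, i ≠ j → k ≠ i → k ≠ j →
      (r a).1 i = j → (r a).1 j = k → (r a).1 k = i → 2 * g ((r a).2 i) < g ((r b).2 i) + g ((r b).2 j))
    (a b z : Fin (n + 1)) (ha1 : (r a).1 = 1) (hb1 : (r b).1 = 1) (hz : ∀ x, (r z).1 x ≠ x)
    (ha : TropicalCensus.classSym (r a) = TropicalCensus.classSym ((1 : Equiv.Perm (Fin 3)), (![0, 1, 3] : Fin 3 → Fin 4)))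
    (hb : TropicalCensus.classSym (r b) = TropicalCensus.classSym ((1 : Equiv.Perm (Fin 3)), (![0, 2, 3] : Fin 3 → Fin 4)))
    (hzc : TropicalCensus.classSym (r z) = TropicalCensus.classSym ((1 : Equiv.Perm (Fin 3)), (![1, 2, 2] : Fin 3 → Fin 4))) : False := by
  obtain ⟨hab, κ0, κ1, κ3, hκ01, hκ30, hκ31, hu0, hu1, hu3, hw0, hw1, hw3⟩ := DD_frame r hM a b ha1 hb1 ha hb
  have cz : ∀ l, (univ.filter fun t => (r z).2 t = l).card = (![0, 1, 2, 0] : Fin 4 → ℕ) l :=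
    fun l => (card_filter_eq_of_classSym_eq hzc l).trans (cnt122 l)
  have haz : a ≠ z := by intro h; rw [h] at ha1; exact fpf_ne_one hz ha1
  have hbz : b ≠ z := by intro h; rw [h] at hb1; exact fpf_ne_one hz hb1
  have z12 : ∀ t, (r z).2 t = 2 ∨ (r z).2 t = 1 := fun t => by
    by_cases h1 : (r z).2 t = 1
    · exact Or.inr h1
    · exact Or.inl (f4_j _ (ne_of_card_zero _ 0 (by rw [cz 0]; rfl) t) h1 (ne_of_card_zero _ 3 (by rw [cz 3]; rfl) t))
  have gz1 : ∀ t, g 1 ≤ g ((r z).2 t) := fun t => by rcases z12 t with h | h <;> rw [h]; exact hmono (by decide)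
  have gz2 : ∀ t, g ((r z).2 t) ≤ g 2 := fun t => by rcases z12 t with h | h <;> rw [h]; exact hmono (by decide)
  have z_ne1 : ∀ {t t' : Fin 3}, (r z).2 t = 1 → t' ≠ t → (r z).2 t' = 2 := fun {t t'} h hne => by
    rcases z12 t' with h' | h'
    · exact h'
    · exact absurd h' (ne_of_card_one _ 1 (by rw [cz 1]; rfl) h hne)
  have g01 : g 0 ≤ g 1 := hmono (by decide)
  have g02 : g 0 ≤ g 2 := hmono (by decide)
  have g12 : g 1 ≤ g 2 := hmono (by decide)
  have g23 : g 2 ≤ g 3 := hmono (by decide)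
  rcases fpf_orient (r z).1 hz κ0 κ1 hκ01 with hor | hor
  · obtain ⟨h13, h30⟩ := fpf_next (r z).1 hz κ0 κ1 κ3 hκ01 hκ30 hκ31 hor
    have haz' : a < z := by
      rcases lt_or_gt_of_ne haz with h | h
      · exact h
      · exfalso
        have hC := hR3' z a h ha1 κ0 κ1 κ3 hκ01 hκ30 hκ31 hor h13 h30
        rw [hu0, hu1] at hC; have := gz1 κ0; omega
    have hzb' : z < b := by
      rcases lt_or_gt_of_ne hbz with h | h
      · exfalso
        have hC := hR3 b z h hb1 κ1 κ3 κ0 hκ31.symm hκ01 hκ30.symm h13 h30 hor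
        rw [hw1, hw3] at hC; have := gz2 κ1; omega
      · exact h
    have c3 := hR3' z b hzb' hb1 κ0 κ1 κ3 hκ01 hκ30 hκ31 hor h13 h30
    rw [hw0, hw1] at c3
    have hz0 : (r z).2 κ0 = 1 := by
      rcases z12 κ0 with h | h
      · rw [h] at c3; omega
      · exact h
    have c2 := hR3 a z haz' ha1 κ3 κ0 κ1 hκ30 hκ31.symm hκ01.symm h30 hor h13
    rw [hu3, hu0, z_ne1 hz0 hκ30] at c2
    have c4 := hR3' z b hzb' hb1 κ3 κ0 κ1 hκ30 hκ31.symm hκ01.symm h30 hor h13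
    rw [hw3, hw0, z_ne1 hz0 hκ30] at c4
    omega
  · obtain ⟨h03, h31⟩ := fpf_next (r z).1 hz κ1 κ0 κ3 hκ01.symm hκ31 hκ30 hor
    have haz' : a < z := by
      rcases lt_or_gt_of_ne haz with h | h
      · exact h
      · exfalso
        have hC := hR3' z a h ha1 κ1 κ0 κ3 hκ01.symm hκ31 hκ30 hor h03 h31
        rw [hu1, hu0] at hC; have := gz1 κ1; omega
    have hzb' : z < b := by
      rcases lt_or_gt_of_ne hbz with h | h
      · exfalso
        have hC := hR3 b z h hb1 κ3 κ1 κ0 hκ31 hκ30.symm hκ01 h31 hor h03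
        rw [hw3, hw1] at hC; have := gz2 κ3; omega
      · exact h
    have c3 := hR3' z b hzb' hb1 κ1 κ0 κ3 hκ01.symm hκ31 hκ30 hor h03 h31
    rw [hw1, hw0] at c3
    have hz1 : (r z).2 κ1 = 1 := by
      rcases z12 κ1 with h | h
      · rw [h] at c3; omega
      · exact h
    have c2 := hR3 a z haz' ha1 κ0 κ3 κ1 hκ30.symm hκ01.symm hκ31.symm h03 h31 hor
    rw [hu0, hu3, z_ne1 hz1 hκ01] at c2
    have c4 := hR3' z b hzb' hb1 κ0 κ3 κ1 hκ30.symm hκ01.symm hκ31.symm h03 h31 hor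
    rw [hw0, hw3, z_ne1 hz1 hκ01] at c4
    omega

end SymmetricOrbitThreeFour

end Summit.ValiantsHypothesis.ValiantsHypothesis.Theorems.KPlusLogSqLaw
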